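import Summits.KontsevichZagierPeriods.KontsevichZagierPeriods.Theorems.ValuedFieldSpecialisationCTConstructionCoreReduction
import Summits.KontsevichZagierPeriods.KontsevichZagierPeriods.Theorems.ValuedFieldSpecialisationDefs

/-!
# Route ValuedFieldSpecialisation — crux `CTConstruction`: the power-only reduction (dilation elimination without log block)

Helper toward crux stmt-KontsevichZagierPeriods-3495 (`CTConstruction`), line `registered`, reshape r4 (blow-up
elimination of the log block), stub `stub_powerOnly_reduction`: the POWER-ONLY case of the dilation elimination of
reshape r3 (`coreReduction_main`, file `…CTConstructionCoreReduction`; `specialFibreRigidityOfEval_of_pure_of_logTwoCancellation`,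
file `…CTConstructionCoreEntry`). From PURE alone ("fibred relations among DOMINATED families specialise"), a fibred
relation `D + G ∈ KZ.fibredRelations` between an integer combination `D` of elementary divergent products
`P(p, q, b, d, r)` with POSITIVE exponent `p` and a dominated combination `G` specialises: `y ∈ KZ.relations` for
every dominated pair `(G, y)`. With no pure-log generator (`p = 0`) present, the log step of the main induction —
the only consumer of the log2-cancellation hypothesis — is unreachable, so that hypothesis disappears:

* `powerReduction_main`: the main induction on the size of the profile of an elimination state over the fixed
  universe of typed families `Rep i S` (all `p i > 0`): empty support — PURE; otherwise apply `(Θ − 2^{p*})`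
  (`theta_D_sub_D_mem`, `theta_mem_fibredRelations`, `theta_mem_closure_dominatedPairs`), recurse
  (`card_profile_lt`) and divide by `2^{p*} − 1` (`mem_relations_of_zsmul_mem`);
* `exists_sum_of_mem_closure_powGenerators`: closure membership for the power generators is the literal `∃`-shape
  (`ℤ`-span = subgroup closure, `Submodule.mem_span_set'`);
* `stub_powerOnly_reduction`: common denominator `Q`, the universe of typed families reachable under the dilation
  `Θ = slabMap 0 1 ∘ dilate(2^{-Q})` (`stub_typedExpansion`, `stub_exists_dilate`, `elementary_domain_eq_typed_empty`),
  and the main induction from the initial state.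

Sources: M. Kontsevich, D. Zagier, *Periods* (2001), §1.2; J. Bochnak, M. Coste, M.-F. Roy, *Real Algebraic
Geometry* (1998) §2.2 where semialgebraic maps are used; the encoding is this route's. No new definitions.
-/

noncomputable section

namespace Summit.KontsevichZagierPeriods.ValuedFieldSpecialisation

open MeasureTheory Set Filter
open scoped Topology
open Literature.NumberTheory.Transcendental Literature.NumberTheory.Transcendental.KZ
open Summit.KontsevichZagierPeriods.HeckeMultiplicityOne (mem_relations_of_zsmul_mem)

section Main

variable {Q : ℕ} (hPURE : ∀ (G y : Literature.NumberTheory.Transcendental.KZ.FormalRep), (G, y) ∈ AddSubgroup.closure {v : Literature.NumberTheory.Transcendental.KZ.FormalRep × Literature.NumberTheory.Transcendental.KZ.FormalRep | ∃ (n : ℕ) (S : Literature.NumberTheory.Transcendental.KZ.IntegralRep (n + 1)) (r₀ g : Literature.NumberTheory.Transcendental.KZ.IntegralRep n), Literature.NumberTheory.Transcendental.KZ.IsDominatedFamily S r₀ g ∧ v = (Literature.NumberTheory.Transcendental.KZ.of S, Literature.NumberTheory.Transcendental.KZ.of r₀)} → G ∈ Literature.NumberTheory.Transcendental.KZ.fibredRelations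 → y ∈ Literature.NumberTheory.Transcendental.KZ.relations)
  {k : ℕ} {p B d : Fin k → ℕ} (hpos : ∀ i, 0 < p i) {r : (i : Fin k) → IntegralRep (d i)}
  {Rep : (i : Fin k) → Finset (Fin (B i)) → IntegralRep (B i + d i + 1 + 1)}
  (hRd : ∀ (i : Fin k) (S : Finset (Fin (B i))), (Rep i S).domain = {z | ∃ (s u : ℝ) (t : Fin (B i) → ℝ) (w : Fin (d i) → ℝ), z = Matrix.vecCons s (Matrix.vecCons u (Fin.append t w)) ∧ 0 < s ∧ s < 1 ∧ 0 < u ∧ u ^ Q * s ^ p i < 1 ∧ (∀ j, ((if j ∈ S then (1 / 2 : ℚ) ^ Q else 1 : ℚ) : ℝ) * s ^ (if j ∈ S then 0 else 1) ≤ t j ∧ t j ≤ 1) ∧ w ∈ (r i).domain})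
  (hRi : ∀ (i : Fin k) (S : Finset (Fin (B i))), (Rep i S).integrand = (fun z => (∏ j : Fin (B i), (z (Fin.castAdd (d i) j).succ.succ)⁻¹) * (r i).integrand (fun l : Fin (d i) => z (Fin.natAdd (B i) l).succ.succ)))
  {T : (Σ n, IntegralRep n) → FormalRep} (hT0 : ∀ ρ : IntegralRep 0, T ⟨0, ρ⟩ = 0)
  (hT : ∀ (n : ℕ) (ρ : IntegralRep (n + 1)), ∃ ρ' : IntegralRep (n + 1), T ⟨n + 1, ρ⟩ = of ρ' ∧
    ρ'.domain = {z | Function.update z 0 ((((1 / 2 : ℚ) ^ Q : ℚ) : ℝ) * z 0) ∈ ρ.domain} ∧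
    ρ'.integrand = fun z => ρ.integrand (Function.update z 0 ((((1 / 2 : ℚ) ^ Q : ℚ) : ℝ) * z 0)))

include hPURE hpos hRd hRi hT0 hT in
/-- **Main induction of the power-only reduction**: `coreReduction_main` on a universe of typed families all of whose
exponents `p i` are positive — the log step is unreachable and no log2-cancellation is needed. Induction on the size
of the profile `Λ c = {(p i, b) | c i S ≠ 0, b ≤ B i − |S|}`: empty support — PURE; otherwise apply `(Θ − 2^{p*})`,
recurse and divide by `2^{p*} − 1`. [folklore] -/
theorem powerReduction_main :
    ∀ (c : (i : Fin k) → Finset (Fin (B i)) → ℤ),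
      ∀ (G y : FormalRep), (G, y) ∈ AddSubgroup.closure {v : Literature.NumberTheory.Transcendental.KZ.FormalRep × Literature.NumberTheory.Transcendental.KZ.FormalRep | ∃ (n : ℕ) (S : Literature.NumberTheory.Transcendental.KZ.IntegralRep (n + 1)) (r₀ g : Literature.NumberTheory.Transcendental.KZ.IntegralRep n), Literature.NumberTheory.Transcendental.KZ.IsDominatedFamily S r₀ g ∧ v = (Literature.NumberTheory.Transcendental.KZ.of S, Literature.NumberTheory.Transcendental.KZ.of r₀)} →
        (∑ i, ∑ S : Finset (Fin (B i)), c i S • of (Rep i S)) + G ∈ fibredRelations → y ∈ relations := by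
  classical
  have hμ : (0 : ℚ) < (1 / 2 : ℚ) ^ Q := half_pow_pos Q
  have hΘmem : ∀ x ∈ fibredRelations, slabMap 0 1 (FreeAbelianGroup.lift T x) ∈ fibredRelations :=
    fun x hx => theta_mem_fibredRelations hμ T hT0 hT hx
  -- the profile of a state
  let lvl : (Σ i, Finset (Fin (B i))) → ℕ := fun x => B x.1 - x.2.card
  let supp : ((i : Fin k) → Finset (Fin (B i)) → ℤ) → Finset (Σ i, Finset (Fin (B i))) := fun c =>
    Finset.univ.sigma fun i => Finset.univ.filter fun S => c i S ≠ 0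
  let Λ : ((i : Fin k) → Finset (Fin (B i)) → ℤ) → Finset (ℕ × ℕ) := fun c =>
    (supp c).biUnion fun x => (Finset.range (lvl x + 1)).image fun b => (p x.1, b)
  have hsupp : ∀ c (x : Σ i, Finset (Fin (B i))), x ∈ supp c ↔ c x.1 x.2 ≠ 0 := by
    intro c x; simp [supp]
  have hΛ : ∀ c q b, (q, b) ∈ Λ c ↔ ∃ x : Σ i, Finset (Fin (B i)), c x.1 x.2 ≠ 0 ∧ p x.1 = q ∧ b ≤ lvl x :=
    fun c q b => mem_profile_iff c q b
  have hcard : ∀ c c' : (i : Fin k) → Finset (Fin (B i)) → ℤ,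
      (∀ i U, c' i U ≠ 0 → ∃ S, S ⊆ U ∧ c i S ≠ 0) → (∃ q b, (q, b) ∈ Λ c ∧ (q, b) ∉ Λ c') →
      (Λ c').card < (Λ c).card := fun c c' hdom hlost => card_profile_lt c c' hdom hlost
  -- class of a state and its linearity
  let D : ((i : Fin k) → Finset (Fin (B i)) → ℤ) → FormalRep := fun c => ∑ i, ∑ S : Finset (Fin (B i)), c i S • of (Rep i S)
  have hDsub : ∀ c c' : (i : Fin k) → Finset (Fin (B i)) → ℤ,
      D (fun i S => c i S - c' i S) = D c - D c' := fun c c' => D_sub c c'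
  have hDmul : ∀ (a : ℤ) (c : (i : Fin k) → Finset (Fin (B i)) → ℤ), D (fun i S => a * c i S) = a • D c :=
    fun a c => D_mul a c
  -- induction on the size of the profile
  suffices H : ∀ (N : ℕ) (c : (i : Fin k) → Finset (Fin (B i)) → ℤ), (Λ c).card ≤ N →
      ∀ (G y : FormalRep), (G, y) ∈ AddSubgroup.closure {v : Literature.NumberTheory.Transcendental.KZ.FormalRep × Literature.NumberTheory.Transcendental.KZ.FormalRep | ∃ (n : ℕ) (S : Literature.NumberTheory.Transcendental.KZ.IntegralRep (n + 1)) (r₀ g : Literature.NumberTheory.Transcendental.KZ.IntegralRep n), Literature.NumberTheory.Transcendental.KZ.IsDominatedFamily S r₀ g ∧ v = (Literature.NumberTheory.Transcendental.KZ.of S, Literature.NumberTheory.Transcendental.KZ.of r₀)} →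
        D c + G ∈ fibredRelations → y ∈ relations by
    intro c G y hGy hF
    exact H _ c le_rfl G y hGy hF
  intro N
  induction N with
  | zero =>
    intro c hN G y hGy hF
    -- empty profile: no support, `D c = 0`, PURE
    have hc0 : ∀ i S, c i S = 0 := by
      intro i S; by_contra h
      have : (p i, 0) ∈ Λ c := (hΛ c (p i) 0).mpr ⟨⟨i, S⟩, h, rfl, Nat.zero_le _⟩
      rw [Nat.le_zero, Finset.card_eq_zero] at hN
      simp [hN] at this
    have hD0 : D c = 0 := by simp [D, hc0]
    rw [hD0, zero_add] at hF
    exact hPURE G y hGy hF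
  | succ N ih =>
    intro c hN G y hGy hF
    by_cases hzero : ∀ i S, c i S = 0
    · have hD0 : D c = 0 := by simp [D, hzero]
      rw [hD0, zero_add] at hF
      exact hPURE G y hGy hF
    push Not at hzero
    /- POWER STEP (the log step of `coreReduction_main` is unreachable: all `p i > 0`) -/
    obtain ⟨i₀, S₀, hi₀⟩ := hzero
    set pstar := p i₀ with hpstar
    have hpstar_pos : 0 < pstar := hpos i₀
    -- the new state `c' = Θ̂ c − 2^{p*} c`
    let c' : (i : Fin k) → Finset (Fin (B i)) → ℤ := fun i U =>
      ((2 ^ p i : ℕ) * ∑ S ∈ U.powerset, c i S : ℤ) - (2 ^ pstar : ℕ) * c i U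
    have hDc' : slabMap 0 1 (FreeAbelianGroup.lift T (D c)) - (2 ^ pstar : ℕ) • D c - D c' ∈ fibredRelations := by
      have h1 := theta_D_sub_D_mem hRd hRi hT c
      have h2 : D c' = (∑ i, ∑ U : Finset (Fin (B i)), ((2 ^ p i : ℕ) * ∑ S ∈ U.powerset, c i S : ℤ) • of (Rep i U)) -
          ((2 ^ pstar : ℕ) : ℤ) • D c := by
        rw [← hDmul]
        rw [← hDsub]
      rw [h2, natCast_zsmul]
      convert h1 using 1
      abel
    -- support of `c'`: below the support of `c`, strictly below at `p*`
    have hsupp' : ∀ i U, c' i U ≠ 0 → ∃ S, S ⊆ U ∧ c i S ≠ 0 := by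
      intro i U hU
      by_contra hcon
      push Not at hcon
      apply hU
      simp only [c']
      rw [Finset.sum_eq_zero (fun S hS => hcon S (Finset.mem_powerset.mp hS)), hcon U le_rfl]
      simp
    have hsupp'' : ∀ i U, c' i U ≠ 0 → p i = pstar → ∃ S, S ⊆ U ∧ S ≠ U ∧ c i S ≠ 0 := by
      intro i U hU hpi
      by_contra hcon
      push Not at hcon
      apply hU
      simp only [c']
      rw [← Finset.sum_erase_add _ _ (Finset.mem_powerset.mpr (subset_refl U))]
      rw [Finset.sum_eq_zero (fun S hS => ?_)]
      · rw [hpi]; ring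
      · rw [Finset.mem_erase, Finset.mem_powerset] at hS
        exact hcon S hS.2 hS.1
    have hlt : (Λ c').card < (Λ c).card := by
      -- a top pair at `p*`
      obtain ⟨x₁, hx₁, hmax⟩ := Finset.exists_max_image ((supp c).filter fun x => p x.1 = pstar) lvl
        ⟨⟨i₀, S₀⟩, by simp [hsupp, hi₀, hpstar]⟩
      rw [Finset.mem_filter, hsupp] at hx₁
      refine hcard c c' hsupp' ⟨pstar, lvl x₁, (hΛ c _ _).mpr ⟨x₁, hx₁.1, hx₁.2, le_rfl⟩, fun hmem => ?_⟩
      rw [hΛ] at hmem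
      obtain ⟨⟨i, U⟩, hU, hpi, hb⟩ := hmem
      obtain ⟨S, hSU, hSne, hS⟩ := hsupp'' i U hU hpi
      have hlt' : lvl ⟨i, U⟩ < lvl ⟨i, S⟩ := by
        simp only [lvl]
        have h1 : S.card < U.card := Finset.card_lt_card (Finset.ssubset_iff_subset_ne.mpr ⟨hSU, hSne⟩)
        have h2 : U.card ≤ B i := by simpa using Finset.card_le_univ U
        omega
      have := hmax ⟨i, S⟩ (by simp [hsupp, hS, hpi])
      omega
    -- the new dominated pair `(Θ G − 2^{p*} G, y − 2^{p*} y)`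
    have hGy' : (slabMap 0 1 (FreeAbelianGroup.lift T G) - (2 ^ pstar : ℕ) • G, y - (2 ^ pstar : ℕ) • y) ∈
        AddSubgroup.closure {v : Literature.NumberTheory.Transcendental.KZ.FormalRep × Literature.NumberTheory.Transcendental.KZ.FormalRep | ∃ (n : ℕ) (S : Literature.NumberTheory.Transcendental.KZ.IntegralRep (n + 1)) (r₀ g : Literature.NumberTheory.Transcendental.KZ.IntegralRep n), Literature.NumberTheory.Transcendental.KZ.IsDominatedFamily S r₀ g ∧ v = (Literature.NumberTheory.Transcendental.KZ.of S, Literature.NumberTheory.Transcendental.KZ.of r₀)} := by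
      have h1 := theta_mem_closure_dominatedPairs hμ T hT hGy
      have h2 := AddSubgroup.nsmul_mem _ hGy (2 ^ pstar)
      simpa using AddSubgroup.sub_mem _ h1 h2
    have hF' : D c' + (slabMap 0 1 (FreeAbelianGroup.lift T G) - (2 ^ pstar : ℕ) • G) ∈ fibredRelations := by
      have h1 : slabMap 0 1 (FreeAbelianGroup.lift T (D c + G)) - (2 ^ pstar : ℕ) • (D c + G) ∈ fibredRelations :=
        fibredRelations.sub_mem (hΘmem _ hF) (fibredRelations.nsmul_mem hF _)
      have h2 := fibredRelations.sub_mem h1 hDc'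
      convert h2 using 1
      simp only [map_add, smul_add]
      abel
    have hy' := ih c' (Nat.lt_succ_iff.mp (lt_of_lt_of_le hlt hN)) _ _ hGy' hF'
    -- divide by `2^{p*} − 1`
    have hy'' : ((2 ^ pstar - 1 : ℕ) : ℤ) • y ∈ relations := by
      have h := relations.neg_mem hy'
      have h1 : (1 : ℕ) ≤ 2 ^ pstar := Nat.one_le_two_pow
      rw [Nat.cast_sub h1]
      convert h using 1
      rw [sub_smul, ← natCast_zsmul y (2 ^ pstar)]
      simp
    refine mem_relations_of_zsmul_mem ?_ hy''
    have : 1 < 2 ^ pstar := Nat.one_lt_two_pow hpstar_pos.ne'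
    omega

end Main

/-- Closure membership for the POWER generators (elementary divergent products with positive exponent `p`) gives the
literal `∃`-shape `D = Σ mᵢ [Pᵢ]` (`ℤ`-span = subgroup closure, `Submodule.mem_span_set'`). [folklore] -/
theorem exists_sum_of_mem_closure_powGenerators (D : FormalRep)
    (hD : D ∈ AddSubgroup.closure {x : Literature.NumberTheory.Transcendental.KZ.FormalRep | ∃ (p q b d : ℕ) (r : Literature.NumberTheory.Transcendental.KZ.IntegralRep d) (P : Literature.NumberTheory.Transcendental.KZ.IntegralRep (b + d + 1 + 1)), 0 < q ∧ 0 < p ∧ P.domain = {z | ∃ (s u : ℝ) (y : Fin b → ℝ) (w : Fin d → ℝ), z = Matrix.vecCons s (Matrix.vecCons u (Fin.append y w)) ∧ 0 < s ∧ s < 1 ∧ 0 < u ∧ u ^ q * s ^ p < 1 ∧ (∀ j, s ≤ y j ∧ y j ≤ 1) ∧ w ∈ r.domain} ∧ P.integrand = (fun z => (∏ j : Fin b, (z (Fin.castAdd d j).succ.succ)⁻¹) * r.integrand (fun l : Fin d => z (Fin.natAdd b l).succ.succ)) ∧ x = Literature.NumberTheory.Transcendental.KZ.of P}) :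
    ∃ (k : ℕ) (m : Fin k → ℤ) (p q b d : Fin k → ℕ) (r : (i : Fin k) → IntegralRep (d i))
      (P : (i : Fin k) → IntegralRep (b i + d i + 1 + 1)),
      (∀ i, 0 < q i ∧ 0 < p i ∧
        (P i).domain = {z | ∃ (s u : ℝ) (y : Fin (b i) → ℝ) (w : Fin (d i) → ℝ),
          z = Matrix.vecCons s (Matrix.vecCons u (Fin.append y w)) ∧ 0 < s ∧ s < 1 ∧ 0 < u ∧
            u ^ (q i) * s ^ (p i) < 1 ∧ (∀ j, s ≤ y j ∧ y j ≤ 1) ∧ w ∈ (r i).domain} ∧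
        (P i).integrand = fun z => (∏ j : Fin (b i), (z (Fin.castAdd (d i) j).succ.succ)⁻¹) *
          (r i).integrand (fun l : Fin (d i) => z (Fin.natAdd (b i) l).succ.succ)) ∧
      D = ∑ i, m i • of (P i) := by
  classical
  rw [← Submodule.span_int_eq_addSubgroupClosure, Submodule.mem_toAddSubgroup] at hD
  obtain ⟨k, m, g, rfl⟩ := Submodule.mem_span_set'.mp hD
  choose p q b d r P hq hp hdom hint hg using fun i => (g i).2
  exact ⟨k, m, p, q, b, d, r, P, fun i => ⟨hq i, hp i, hdom i, hint i⟩,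
    Finset.sum_congr rfl fun i _ => by rw [hg i]⟩

/-- **Registered stub `stub_powerOnly_reduction`** (crux `CTConstruction`, line `registered`, reshape r4): the
POWER-ONLY dilation elimination — from PURE alone, a fibred relation between an integer combination of elementary
divergent products with positive exponent and a dominated combination specialises. Proof: write `D = Σ mᵢ [Pᵢ]`
(`exists_sum_of_mem_closure_powGenerators`), bring the exponents to the common denominator `Q = ∏ qᵢ`
(`elementary_domain_eq_typed_empty`; the new exponents `pᵢ · (Q / qᵢ)` stay positive), choose the universe of typed
families reachable under `Θ` (`stub_typedExpansion`, `stub_exists_dilate`) and run `powerReduction_main` from the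
initial state. [folklore] -/
theorem stub_powerOnly_reduction : (∀ (G y : Literature.NumberTheory.Transcendental.KZ.FormalRep), (G, y) ∈ AddSubgroup.closure {v : Literature.NumberTheory.Transcendental.KZ.FormalRep × Literature.NumberTheory.Transcendental.KZ.FormalRep | ∃ (n : ℕ) (S : Literature.NumberTheory.Transcendental.KZ.IntegralRep (n + 1)) (r₀ g : Literature.NumberTheory.Transcendental.KZ.IntegralRep n), Literature.NumberTheory.Transcendental.KZ.IsDominatedFamily S r₀ g ∧ v = (Literature.NumberTheory.Transcendental.KZ.of S, Literature.NumberTheory.Transcendental.KZ.of r₀)} → G ∈ Literature.NumberTheory.Transcendental.KZ.fibredRelations → y ∈ Literature.NumberTheory.Transcendental.KZ.relations) → ∀ D ∈ AddSubgroup.closure {x : Literature.NumberTheory.Transcendental.KZ.FormalRep | ∃ (p q b d : ℕ) (r : Literature.NumberTheory.Transcendental.KZ.IntegralRep d) (P : Literature.NumberTheory.Transcendental.KZ.IntegralRep (b + d + 1 + 1)), 0 < q ∧ 0 < p ∧ P.domain = {z | ∃ (s u : ℝ) (y : Fin b → ℝ) (w : Fin d → ℝ), z = Matrix.vecCons s (Matrix.vecCons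 u (Fin.append y w)) ∧ 0 < s ∧ s < 1 ∧ 0 < u ∧ u ^ q * s ^ p < 1 ∧ (∀ j, s ≤ y j ∧ y j ≤ 1) ∧ w ∈ r.domain} ∧ P.integrand = (fun z => (∏ j : Fin b, (z (Fin.castAdd d j).succ.succ)⁻¹) * r.integrand (fun l : Fin d => z (Fin.natAdd b l).succ.succ)) ∧ x = Literature.NumberTheory.Transcendental.KZ.of P}, ∀ (G y : Literature.NumberTheory.Transcendental.KZ.FormalRep), (G, y) ∈ AddSubgroup.closure {v : Literature.NumberTheory.Transcendental.KZ.FormalRep × Literature.NumberTheory.Transcendental.KZ.FormalRep | ∃ (n : ℕ) (S : Literature.NumberTheory.Transcendental.KZ.IntegralRep (n + 1)) (r₀ g : Literature.NumberTheory.Transcendental.KZ.IntegralRep n), Literature.NumberTheory.Transcendental.KZ.IsDominatedFamily S r₀ g ∧ v = (Literature.NumberTheory.Transcendental.KZ.of S, Literature.NumberTheory.Transcendental.KZ.of r₀)} → D + G ∈ Literature.NumberTheory.Transcendental.KZ.fibredRelations → y ∈ Literature.NumberTheory.Transcendental.KZ.relations := by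
  intro hPURE D hD G y hGy hF
  classical
  obtain ⟨k, m, p₀, q, b, d, r, P, hP, rfl⟩ := exists_sum_of_mem_closure_powGenerators D hD
  -- common denominator of the exponents
  set Q : ℕ := ∏ i, q i with hQdef
  have hQ : 0 < Q := Finset.prod_pos fun i _ => (hP i).1
  have hqQ : ∀ i, q i ∣ Q := fun i => Finset.dvd_prod_of_mem _ (Finset.mem_univ i)
  let p : Fin k → ℕ := fun i => p₀ i * (Q / q i)
  have hpos : ∀ i, 0 < p i := by
    intro i
    have hdiv : Q / q i ≠ 0 := by
      obtain ⟨e, he⟩ := hqQ i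
      rw [he, Nat.mul_div_cancel_left _ (hP i).1]
      rintro rfl
      rw [mul_zero] at he
      exact hQ.ne' he
    exact Nat.mul_pos (hP i).2.1 (Nat.pos_of_ne_zero hdiv)
  -- a generatorwise choice of dilates by `μ = 2^{-Q}`
  have hdil : ∀ (n : ℕ) (ρ : IntegralRep (n + 1)), ∃ ρ' : IntegralRep (n + 1),
      ρ'.domain = {z | Function.update z 0 ((((1 / 2 : ℚ) ^ Q : ℚ) : ℝ) * z 0) ∈ ρ.domain} ∧
      ρ'.integrand = fun z => ρ.integrand (Function.update z 0 ((((1 / 2 : ℚ) ^ Q : ℚ) : ℝ) * z 0)) :=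
    fun n ρ => stub_exists_dilate ((1 / 2 : ℚ) ^ Q) (half_pow_pos Q) n ρ
  choose dil hdd hdi using hdil
  let T : (Σ n, IntegralRep n) → FormalRep := fun x => match x with
    | ⟨0, _⟩ => 0
    | ⟨n + 1, ρ⟩ => of (dil n ρ)
  have hT0 : ∀ ρ : IntegralRep 0, T ⟨0, ρ⟩ = 0 := fun _ => rfl
  have hT : ∀ (n : ℕ) (ρ : IntegralRep (n + 1)), ∃ ρ' : IntegralRep (n + 1), T ⟨n + 1, ρ⟩ = of ρ' ∧
      ρ'.domain = {z | Function.update z 0 ((((1 / 2 : ℚ) ^ Q : ℚ) : ℝ) * z 0) ∈ ρ.domain} ∧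
      ρ'.integrand = fun z => ρ.integrand (Function.update z 0 ((((1 / 2 : ℚ) ^ Q : ℚ) : ℝ) * z 0)) :=
    fun n ρ => ⟨dil n ρ, rfl, hdd n ρ, hdi n ρ⟩
  -- the generators are the typed families of shape `∅`
  have hPtd : ∀ i, (P i).domain = {z | ∃ (s u : ℝ) (t : Fin (b i) → ℝ) (w : Fin (d i) → ℝ), z = Matrix.vecCons s (Matrix.vecCons u (Fin.append t w)) ∧ 0 < s ∧ s < 1 ∧ 0 < u ∧ u ^ Q * s ^ (p i) < 1 ∧ (∀ j, ((if j ∈ (∅ : Finset (Fin (b i))) then (1 / 2 : ℚ) ^ Q else 1 : ℚ) : ℝ) * s ^ (if j ∈ (∅ : Finset (Fin (b i))) then 0 else 1) ≤ t j ∧ t j ≤ 1) ∧ w ∈ (r i).domain} :=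
    fun i => elementary_domain_eq_typed_empty (hP i).1 hQ (hqQ i) (r i) (P i) (hP i).2.2.1
  -- the universe of typed families reachable from the generators
  have hRep : ∀ (i : Fin k) (S : Finset (Fin (b i))), ∃ R : IntegralRep (b i + d i + 1 + 1),
      R.domain = {z | ∃ (s u : ℝ) (t : Fin (b i) → ℝ) (w : Fin (d i) → ℝ), z = Matrix.vecCons s (Matrix.vecCons u (Fin.append t w)) ∧ 0 < s ∧ s < 1 ∧ 0 < u ∧ u ^ Q * s ^ (p i) < 1 ∧ (∀ j, ((if j ∈ S then (1 / 2 : ℚ) ^ Q else 1 : ℚ) : ℝ) * s ^ (if j ∈ S then 0 else 1) ≤ t j ∧ t j ≤ 1) ∧ w ∈ (r i).domain} ∧ R.integrand = (fun z => (∏ j : Fin (b i), (z (Fin.castAdd (d i) j).succ.succ)⁻¹) * (r i).integrand (fun l : Fin (d i) => z (Fin.natAdd (b i) l).succ.succ)) := by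
    intro i S
    obtain ⟨f, hf, -⟩ := stub_typedExpansion Q (p i) (2 ^ p i) (b i) (d i) ((1 / 2 : ℚ) ^ Q) (r i) ∅ (P i)
      ((dil _ (P i)).slabRestrict 0 1) (half_pow_pos Q) (half_pow_le_one Q) (pow_pos two_pos _)
      (two_pow_pow_mul_half_pow_pow Q (p i)) (hPtd i) (hP i).2.2.2
      (by rw [IntegralRep.domain_slabRestrict, hdd]) (by rw [IntegralRep.integrand_slabRestrict, hdi])
    exact ⟨f S, (hf S (Finset.empty_subset S)).1, (hf S (Finset.empty_subset S)).2⟩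
  choose Rep hRd hRi using hRep
  -- the initial state
  let c₀ : (i : Fin k) → Finset (Fin (b i)) → ℤ := fun i S => if S = ∅ then m i else 0
  have hRep0 : ∀ i, Rep i ∅ = P i := fun i =>
    IntegralRep.ext' ((hRd i ∅).trans (hPtd i).symm) ((hRi i ∅).trans (hP i).2.2.2.symm)
  have hD0 : (∑ i, ∑ S : Finset (Fin (b i)), c₀ i S • of (Rep i S)) = ∑ i, m i • of (P i) := by
    refine Finset.sum_congr rfl fun i _ => ?_
    rw [Finset.sum_eq_single_of_mem ∅ (Finset.mem_univ _) (fun S _ hS => by simp [c₀, hS])]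
    simp [c₀, hRep0]
  refine powerReduction_main hPURE hpos hRd hRi hT0 hT c₀ G y hGy ?_
  rw [hD0]
  exact hF

end Summit.KontsevichZagierPeriods.ValuedFieldSpecialisation
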